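import Mathlib

/-!
# P7K2Lattice — kernel-checked lattice facts behind the K3-step obstruction (pub-hodge-repro0, P7-K2Obstruction §4)

The index-minimal even integral lattices `T_min(A)`, `T_min(B)` inside `W_ℤ(1/24)` of the new cyclic families
(A) y¹² = x²(x−1)³(x−λ)⁶ and (B) y¹² = x³(x−1)⁴(x−λ)⁴ (proofs/p7-scripts/tsub.py), and the control `W_ℤ(1/24)` of Moonen's
row (20). Everything certified here is a FINITE integer computation on a 4×4 Gram matrix `G`:
* `det G = 36` (resp. `1` for the control), every diagonal entry even;
* the classes of order 2 of the discriminant group `A = G⁻¹ℤ⁴/ℤ⁴`, i.e. the nonzero `x ∈ {0,1}⁴` with `G x ≡ 0 (mod 2)`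
  (`v = x/2 ∈ A[2]`), are EXACTLY three, and each has `xᵀ G x ≡ 4 (mod 8)`, i.e. `q(v) = xᵀGx/4 ≡ 1 (mod 2)` — the
  anisotropic form `q_{D₄}` on `(ℤ/2)²`;
* the classes of order 3 (`x ∈ {0,1,2}⁴ ∖ 0` with `G x ≡ 0 (mod 3)`) are exactly eight, with `xᵀ G x ≡ 6 or 12 (mod 18)`,
  i.e. `q(x/3) ∈ {2/3, 4/3}` — the anisotropic form `q_{A₂} ⊕ q_{A₂}` on `(ℤ/3)²`;
* there is no element of order 4 (`x ∈ {0,…,3}⁴` with an odd coordinate and `G x ≡ 0 (mod 4)`) and none of order 9,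
  so `A ≅ (ℤ/6)²` (order 36 = |det G|);
* for the two even binary lattices of signature (1,1) with discriminant group `(ℤ/6)²`, `U(6) = [[0,6],[6,0]]` and
  `⟨6⟩ ⊕ ⟨−6⟩`, the values `xᵀKx mod 8` (`Int.emod`, non-negative) on the order-2 classes are `{0,0,4}` resp. `{2,6,0}`, NOT `{4,4,4}`.
Consequence (P7-K2Obstruction §4, with Nikulin's Thm 1.12.2 and the classification of unimodular indefinite binary
forms, neither certified here): no even binary `K` has `q_K ≅ −q_T`, so `T_min` has no primitive embedding into `U³`
and `Ỹ_λ` has no Shioda–Inose structure. Finite arithmetic only (ROUTE R-5); the lattices themselves come from the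
scripts (tlattice.py / tsub.py) and the class-level proof is §1–§3 of the file.
-/

namespace HodgeRepro0.P7K2Lattice

/-- a 4×4 integer Gram matrix as a list of rows -/
abbrev Gram := List (List Int)
/-- `G x` -/
def gx (G : Gram) (x : List Int) : List Int := G.map (fun row => (List.zipWith (· * ·) row x).sum)
/-- `xᵀ G x` -/
def quad (G : Gram) (x : List Int) : Int := (List.zipWith (· * ·) x (gx G x)).sum
/-- all vectors in `{0,…,n−1}⁴` -/
def box (n : Nat) : List (List Int) :=
  let r := (List.range n).map (fun k => (k : Int))
  r.flatMap (fun a => r.flatMap (fun b => r.flatMap (fun c => r.map (fun d => [a, b, c, d]))))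
/-- `x ≠ 0` -/
def nonzero (x : List Int) : Bool := x.any (· != 0)
/-- `G x ≡ 0 (mod m)` -/
def divisible (G : Gram) (m : Int) (x : List Int) : Bool := (gx G x).all (fun v => v % m == 0)
/-- the nonzero classes of order `p` (`p` prime): `x ∈ {0,…,p−1}⁴ ∖ 0` with `G x ≡ 0 (mod p)` -/
def orderClasses (G : Gram) (p : Nat) : List (List Int) := (box p).filter (fun x => nonzero x && divisible G (p : Int) x)
/-- elements of order `p²` in `A`: `x ∈ {0,…,p²−1}⁴` with some coordinate not divisible by `p` and `G x ≡ 0 (mod p²)` -/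
def orderSq (G : Gram) (p : Nat) : List (List Int) :=
  (box (p * p)).filter (fun x => x.any (fun v => v % (p : Int) != 0) && divisible G ((p * p : Nat) : Int) x)
/-- determinant of a 4×4 matrix by Laplace expansion -/
def det2 (a b c d : Int) : Int := a * d - b * c
/-- determinant of a 3×3 matrix given as rows -/
def det3 (m : List (List Int)) : Int :=
  match m with
  | [[a, b, c], [d, e, f], [g, h, i]] => a * det2 e f h i - b * det2 d f g i + c * det2 d e g h
  | _ => 0
/-- the 3×3 minor of a 4×4 matrix obtained by deleting row `i` and column `j` -/
def minor (G : Gram) (i j : Nat) : List (List Int) :=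
  ((List.range 4).filter (· != i)).map (fun r => ((List.range 4).filter (· != j)).map (fun c => (G.getD r []).getD c 0))
/-- determinant of a 4×4 matrix (Laplace expansion along the first row) -/
def det4 (G : Gram) : Int :=
  match G.headD [] with
  | [a, b, c, d] => a * det3 (minor G 0 0) - b * det3 (minor G 0 1) + c * det3 (minor G 0 2) - d * det3 (minor G 0 3)
  | _ => 0
/-- all diagonal entries even -/
def evenDiag (G : Gram) : Bool := (List.range 4).all (fun i => ((G.getD i []).getD i 1) % 2 == 0)

/-- `T_min(A)`: the unique integral even sublattice of index 4 of `W_ℤ(A)(1/24)` (tsub.py) -/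
def TA : Gram := [[-10, -11, -6, -12], [-11, -14, -8, -12], [-6, -8, -4, -6], [-12, -12, -6, -12]]
/-- `T_min(B)`: the unique integral even sublattice of index 9 of `W_ℤ(B)(1/24)` (tsub.py) -/
def TB : Gram := [[2, 1, 0, 0], [1, -2, -3, 3], [0, -3, -6, 0], [0, 3, 0, -6]]
/-- the control: `W_ℤ(1/24)` of Moonen's row (20), even unimodular = U ⊕ U (the cell's K2 for row (20)) -/
def W20 : Gram := [[-4, 0, -2, -3], [0, 0, -1, -1], [-2, -1, 0, 0], [-3, -1, 0, 0]]
/-- `U(6)` -/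
def U6 : Gram := [[0, 6], [6, 0]]
/-- `⟨6⟩ ⊕ ⟨−6⟩` -/
def D6 : Gram := [[6, 0], [0, -6]]
/-- the three nonzero classes of order 2 of `A_{T_min}` for (A) resp. (B), in the enumeration order of `box 2` -/
def order2A : List (List Int) := [[0, 0, 0, 1], [0, 0, 1, 0], [0, 0, 1, 1]]
/-- the three nonzero classes of order 2 of `A_{T_min(B)}`, in the enumeration order of `box 2` -/
def order2B : List (List Int) := [[0, 0, 1, 1], [1, 0, 0, 1], [1, 0, 1, 0]]
/-- the nonzero classes of order 2 of a binary lattice: `x ∈ {0,1}² ∖ 0` with `K x ≡ 0 (mod 2)` -/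
def box2 : List (List Int) := [[0, 1], [1, 0], [1, 1]]

/-- `det T_min(A) = 36` -/
theorem det_TA : det4 TA = 36 := by decide +kernel
/-- `det T_min(B) = 36` -/
theorem det_TB : det4 TB = 36 := by decide +kernel
/-- the control `W_ℤ(20)(1/24)` is unimodular -/
theorem det_W20 : det4 W20 = 1 := by decide +kernel
/-- `T_min(A)` is even -/
theorem even_TA : evenDiag TA = true := by decide +kernel
/-- `T_min(B)` is even -/
theorem even_TB : evenDiag TB = true := by decide +kernel
/-- the control lattice is even -/
theorem even_W20 : evenDiag W20 = true := by decide +kernel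
/-- (A): exactly three classes of order 2, every one with `xᵀGx ≡ 4 (mod 8)`, i.e. `q ≡ 1 (mod 2)` -/
theorem order2_TA : orderClasses TA 2 = order2A ∧ order2A.all (fun x => quad TA x % 8 == 4) = true := by decide +kernel
/-- (B): exactly three classes of order 2, each with `q ≡ 1 (mod 2)` -/
theorem order2_TB : orderClasses TB 2 = order2B ∧ order2B.all (fun x => quad TB x % 8 == 4) = true := by decide +kernel
/-- (A): exactly eight classes of order 3, every one with `xᵀGx ≡ 6 or 12 (mod 18)`, i.e. `q ∈ {2/3, 4/3}` -/
theorem order3_TA : (orderClasses TA 3).length = 8 ∧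
    (orderClasses TA 3).all (fun x => quad TA x % 18 == 6 || quad TA x % 18 == 12) = true := by decide +kernel
/-- (B): exactly eight classes of order 3 with `q ∈ {2/3, 4/3}` -/
theorem order3_TB : (orderClasses TB 3).length = 8 ∧
    (orderClasses TB 3).all (fun x => quad TB x % 18 == 6 || quad TB x % 18 == 12) = true := by decide +kernel
/-- (A): no element of order 4 (with `noOrder9_TA`: the discriminant group is `(ℤ/6)²`) -/
theorem noOrder4_TA : orderSq TA 2 = [] := by decide +kernel
/-- (B): no element of order 4 -/
theorem noOrder4_TB : orderSq TB 2 = [] := by decide +kernel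
/-- (A): no element of order 9 -/
theorem noOrder9_TA : orderSq TA 3 = [] := by decide +kernel
/-- (B): no element of order 9 -/
theorem noOrder9_TB : orderSq TB 3 = [] := by decide +kernel
/-- the control lattice is unimodular: no class of order 2 or 3 at all -/
theorem unimodular_W20 : orderClasses W20 2 = [] ∧ orderClasses W20 3 = [] := by decide +kernel
/-- `U(6)`: order-2 values `{0, 0, 4}` mod 8 — never all `4` -/
theorem binary_U6 : box2.map (fun x => quad U6 x % 8) = [0, 0, 4] := by decide +kernel
/-- `⟨6⟩ ⊕ ⟨−6⟩`: order-2 values `{2, 6, 0}` mod 8 -/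
theorem binary_D6 : box2.map (fun x => quad D6 x % 8) = [2, 6, 0] := by decide +kernel

end HodgeRepro0.P7K2Lattice
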